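import Literature.NumberTheory.Sieve.FriedlanderIwaniecPrimesGaussianSector
import Literature.NumberTheory.Sieve.FriedlanderIwaniecPrimesDivisorLemma
import Literature.NumberTheory.Sieve.FriedlanderIwaniecPrimesBilinearCounting
import Mathlib.Analysis.SpecialFunctions.Trigonometric.Bounds
import Mathlib.NumberTheory.Harmonic.Bounds
import HarnessLib

/-!
# Friedlander–Iwaniec, *The polynomial `X² + Y⁴` captures its primes*, §5: the trivial bound (5.16) for a sector form

Family `parity`, statement parity.S17 (`setOf_prime_sq_add_pow_four_infinite`). Source: J. Friedlander,
H. Iwaniec, Ann. of Math. (2) 148 (1998), 945–1040 [FriedlanderIwaniecAnnals1998], §5, (5.14)–(5.16):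
"The intersection of the annulus (4.12) with the sector (5.12) is a polar box (5.14)
`𝔅 = {z : N' < |z|² ≤ (1+θ)N', φ < arg z ≤ φ + 2πθ}` … we now need to prove that for the bilinear
form `B(M, N)` restricted smoothly to a box we have (5.15) … whereas the trivial bound is
(5.16) `B(M, N) ≪ θ² (MN)^{3/4} (log N)²`. Indeed, arguing along the same lines as for (5.10) we have
`B(M, N) ≪ Σ_{M < u²+v² ≤ 2M} Σ_{r+is ∈ 𝔅, ur+vs = □} |β(r²+s²)| ≪ M^{3/4} N^{-1/4} Σ_{r+is ∈ 𝔅} |β(r²+s²)|`.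
By Lemma 2.2 `|β(r²+s²)| ≤ τ(r²+s²) ≤ 9 Σ_{d ∣ r²+s², d ≤ N^{1/3}} τ(d)`. Given such a `d`, we have
`#{r+is ∈ 𝔅 ; r²+s² ≡ 0 (d)} ≪ θ² N ρ(d) d⁻¹`. Moreover we have `Σ_{d ≤ N^{1/3}} ρ(d) τ(d) d⁻¹ ≪ (log N)²`.
These estimates yield the bound (5.16)." It is used for the sectors near the axes: "the other
sectors, altogether of angle `≤ 2πϑ`, contribute no more than the bound (4.23) by the estimate (5.16)".

Everything here is PROVED. This is one of the inputs of the reduction of (4.23)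
(`FriedlanderIwaniec1998_bilinear423`) to (5.15) (`FriedlanderIwaniec1998_bilinear515`); the others
are (5.2)–(5.6) (`…GaussianParam`, `…GaussianForm`), the partition (5.12)–(5.13)
(`…AngularPartition`), and (5.8)–(5.10) (the removal of `(w w̄, z z̄) = 1`, not in this file).

## Main results

* `norm_fiGaussSector_le_secW_mul_boxDivSum` — the combinatorial form: for `|α| ≤ 1`, `|p| ≤ 1`,
  `|q| ≤ 1`, `q` supported on `φ < u ≤ φ + 2πθ (mod 2π)`, `0 < θ ≤ 1/2`:
  `‖B(M, N)‖ ≤ W · 9 Σ_{d ≤ Y^{1/3}} τ(d)² d (⌊L/d⌋ + 1)²`, `Y = ⌊(1+θ)N'⌋`, `L = ⌊18 θ √N'⌋`,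
  `W = (2⌊(⌊2M⌋Y)^{1/4}⌋ + 1)(4√(2M/N') + 1)`;
* `norm_fiGaussSector_le_trivial` — **(5.16)** in closed form: under `1 ≤ N' ≤ M` and
  `N' ≤ (θ√N')³` (i.e. `θ ≥ N'^{-1/6}`), `‖B(M, N)‖ ≤ 10⁶ θ² (MN')^{3/4} (1 + log N')⁴`, uniformly in
  the class `z₀` of (5.7), the sector, and `C, P, τ`.

## Proof (as printed, made effective)

* `card_le_of_line_step`, `card_wSlice_le`, `wCount_le`: for `z = r + is` with `(r, s) = 1` and a
  given `c`, the `w = u + iv` with `ur + vs = c²` lie on a line at mutual distances `≥ |z|`, so there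
  are `≤ 4√(2M/|z|²) + 1` of them in `|w|² ≤ 2M`; `|c| ≤ (2M|z|²)^{1/4}` by Cauchy–Schwarz; hence
  `W(z) = Σ_{M<|w|²≤2M} 𝔷(Re w̄ z) ≤ (2c⁰+1)(4√(2M/|z|²)+1)` ("`≪ M^{3/4} N^{-1/4}`"). The version with a
  step divisible by `g` (`card_le_of_line_step`) serves (5.10) as well.
* `polarBox_subset`: the polar box lies in the square of half-side `9θ√N'` centred at `√N' e^{iφ}`
  (`|cos ψ - cos φ| ≤ |ψ - φ|`, `√(1+θ) ≤ 1 + θ/2`).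
* `card_box_filter_dvd_normSq_le`: `#{z ∈ box : d ∣ |z|²} ≤ N(d) (side/d + 1)²` with
  `N(d) = #{(a, b) mod d : d ∣ a² + b²} ≤ τ(d) d` for squarefree `d` (tree, `pairCongrCount_le_of_squarefree`;
  the source's `ρ(d) d`);
* `sum_box_tau_le`: Lemma 2.2 (tree, `card_divisors_le_nine_mul_sum`) and the exchange of `z` and `d`;
* `boxDivSum_le`, `secDivSum_le`: `Σ_{d ≤ Y^{1/3}} τ(d)² d (L/d+1)² ≤ (Λ² + (2Λ + D)D)(1 + log Y)⁴` from
  `Σ_{d ≤ Y} τ(d)²/d ≤ (1 + log Y)⁴` (`sum_tau_sq_div_le`, a local copy of the tree's `divPowSum_le`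
  pattern) — the printed `(log N)²` uses `ρ(d) ≤ 2^{ω(d)}`; `τ(d)` costs two logarithms, immaterial for
  the use near the axes (the saving sought there is `ϑ⁻¹`, an arbitrary power of `log N`, and `θ ≤ ϑ`).

## References

* J. Friedlander, H. Iwaniec, Ann. of Math. (2) 148 (1998), 945–1040, §5 (5.14)–(5.16), Lemma 2.2.
  [FriedlanderIwaniecAnnals1998]

## Tree / Mathlib

Tree: `fiGaussSector`, `gaussArg`, `GaussCongrEight` (`…GaussianSector`); `sqPairs`, `toGauss`, `fiZeta`
(`…GaussianParam`); `fiBeta`, `abs_fiBeta_le` (`…BilinearForm`); `smallDivisors`,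
`card_divisors_le_nine_mul_sum`, `pairCongrCount`, `pairCongrCount_le_of_squarefree` (`…DivisorLemma`);
`card_Icc_filter_dvd_sub_le'` (`…BilinearCounting`); `mem_Icc_sqrt_sqrt_of_pow_four_le`
(`FriedlanderIwaniecPrimes`); `primaryNormEq` (`QuadraticFields.GaussianPrimary`). Mathlib:
`Complex.norm_mul_cos_arg`, `Real.abs_cos_sub_cos_le`, `harmonic_le_one_add_log`,
`Real.nat_sqrt_le_real_sqrt`.
-/

noncomputable section

open Finset Real
open scoped ArithmeticFunction.Moebius ArithmeticFunction.sigma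
open Literature.NumberTheory.QuadraticFields.GaussianPrimary

namespace Literature.NumberTheory.Sieve.FriedlanderIwaniecPrimes

/-! ### Lattice points on a line inside a disc -/

/-- Two solutions of `u r + v s = k` differ by `t (s, -r)` with `t = b δu - a δv` when `a r + b s = 1`.
[folklore] -/
theorem line_param {r s a b : ℤ} (hab : a * r + b * s = 1) {u v u' v' : ℤ}
    (h : u * r + v * s = u' * r + v' * s) :
    u' = u + s * (b * (u' - u) - a * (v' - v)) ∧ v' = v - r * (b * (u' - u) - a * (v' - v)) := by
  constructor
  · linear_combination (-(u' - u)) * hab + (-a) * h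
  · linear_combination (-(v' - v)) * hab + (-b) * h

/-- Points of `ℤ²` in the disc `u² + v² ≤ R₂` any two of which differ by `t (s, -r)` with `g ∣ t`
number at most `4 √(R₂/(r² + s²)) / g + 1`. [folklore] -/
theorem card_le_of_line_step {r s : ℤ} (hn : 0 < r ^ 2 + s ^ 2) {g : ℕ} (hg : 0 < g) {R₂ : ℝ}
    (hR : 0 ≤ R₂) (S : Finset (ℤ × ℤ))
    (hdisc : ∀ uv ∈ S, ((uv.1 ^ 2 + uv.2 ^ 2 : ℤ) : ℝ) ≤ R₂)
    (hline : ∀ uv ∈ S, ∀ uv' ∈ S, ∃ t : ℤ, (g : ℤ) ∣ t ∧ uv'.1 = uv.1 + s * t ∧ uv'.2 = uv.2 - r * t) :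
    (#S : ℝ) ≤ 4 * Real.sqrt (R₂ / (r ^ 2 + s ^ 2 : ℤ)) / g + 1 := by
  rcases S.eq_empty_or_nonempty with rfl | ⟨b₀, hb₀⟩
  · simp; positivity
  classical
  -- the step parameter of each point relative to `b₀`
  have key : ∀ uv ∈ S, ∃ t : ℤ, (g : ℤ) ∣ t ∧ uv.1 = b₀.1 + s * t ∧ uv.2 = b₀.2 - r * t :=
    fun uv huv => hline b₀ hb₀ uv huv
  choose! t ht using key
  set T : ℝ := Real.sqrt (R₂ / (r ^ 2 + s ^ 2 : ℤ)) with hT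
  have hnR : (0 : ℝ) < (r ^ 2 + s ^ 2 : ℤ) := by exact_mod_cast hn
  -- `|t| ≤ 2T`
  have htb : ∀ uv ∈ S, |(t uv : ℝ)| ≤ 2 * T := by
    intro uv huv
    obtain ⟨-, h1, h2⟩ := ht uv huv
    have hsq : ((t uv : ℝ)) ^ 2 * ((r ^ 2 + s ^ 2 : ℤ) : ℝ) ≤ 4 * R₂ := by
      have e : ((t uv : ℝ)) ^ 2 * ((r ^ 2 + s ^ 2 : ℤ) : ℝ) =
          ((uv.1 - b₀.1) ^ 2 + (uv.2 - b₀.2) ^ 2 : ℤ) := by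
        push_cast
        have e1 : ((uv.1 : ℝ)) - b₀.1 = s * t uv := by
          have := congrArg (fun z : ℤ => (z : ℝ)) h1; push_cast at this; linarith
        have e2 : ((uv.2 : ℝ)) - b₀.2 = -(r * t uv) := by
          have := congrArg (fun z : ℤ => (z : ℝ)) h2; push_cast at this; linarith
        rw [e1, e2]; ring
      rw [e]
      have h3 := hdisc uv huv
      have h4 := hdisc b₀ hb₀
      have h5 : (((uv.1 - b₀.1) ^ 2 + (uv.2 - b₀.2) ^ 2 : ℤ) : ℝ) ≤
          2 * ((uv.1 ^ 2 + uv.2 ^ 2 : ℤ) : ℝ) + 2 * ((b₀.1 ^ 2 + b₀.2 ^ 2 : ℤ) : ℝ) := by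
        push_cast
        nlinarith [sq_nonneg ((uv.1 : ℝ) + b₀.1), sq_nonneg ((uv.2 : ℝ) + b₀.2)]
      linarith
    have hsq' : ((t uv : ℝ)) ^ 2 ≤ (2 * T) ^ 2 := by
      have e : (2 * T) ^ 2 = 4 * R₂ / ((r ^ 2 + s ^ 2 : ℤ) : ℝ) := by
        rw [mul_pow, hT, Real.sq_sqrt (by positivity)]; ring
      rw [e, le_div_iff₀ hnR]
      exact hsq
    exact abs_le_of_sq_le_sq' hsq' (by positivity) |> fun h => abs_le.mpr h
  -- inject `S` into the multiples-of-`g` description: `uv ↦ t uv / g`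
  have hinj : Set.InjOn (fun uv => t uv / (g : ℤ)) S := by
    intro uv huv uv' huv' h
    obtain ⟨hd, h1, h2⟩ := ht uv huv
    obtain ⟨hd', h1', h2'⟩ := ht uv' huv'
    have : t uv = t uv' := by
      have e := Int.ediv_mul_cancel hd
      have e' := Int.ediv_mul_cancel hd'
      simp only at h
      rw [← e, ← e', h]
    exact Prod.ext (by rw [h1, h1', this]) (by rw [h2, h2', this])
  set U : ℤ := ⌊2 * T / g⌋ with hU
  have hmaps : Set.MapsTo (fun uv => t uv / (g : ℤ)) S (Icc (-U) U : Finset ℤ) := by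
    intro uv huv
    obtain ⟨hd, -, -⟩ := ht uv huv
    have hb := abs_le.mp (htb uv huv)
    have hgR : (0 : ℝ) < g := by exact_mod_cast hg
    obtain ⟨q, hq⟩ := hd
    have hq' : t uv / (g : ℤ) = q := by
      rw [hq, Int.mul_ediv_cancel_left _ (by exact_mod_cast hg.ne')]
    rw [mem_coe, mem_Icc]
    change -U ≤ t uv / (g : ℤ) ∧ t uv / (g : ℤ) ≤ U
    rw [hq']
    have hqR : (t uv : ℝ) = g * q := by rw [hq]; push_cast; ring
    have hq1 : (q : ℝ) ≤ 2 * T / g := by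
      rw [le_div_iff₀ hgR]; nlinarith [hb.2]
    have hq2 : -(2 * T / g) ≤ (q : ℝ) := by
      rw [neg_le, le_div_iff₀ hgR]; nlinarith [hb.1]
    constructor
    · have : -U - 1 < q := by
        have h1 : 2 * T / g < (U : ℝ) + 1 := Int.lt_floor_add_one _
        have : (-(U : ℝ) - 1) < q := by linarith
        exact_mod_cast this
      omega
    · exact Int.le_floor.mpr hq1
  have hcard := card_le_card_of_injOn _ hmaps hinj
  have hU0 : 0 ≤ U := by
    rw [hU]; exact Int.floor_nonneg.mpr (by positivity)
  have hcU : (#(Icc (-U) U) : ℝ) = 2 * U + 1 := by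
    rw [Int.card_Icc]
    have : ((U + 1 - -U).toNat : ℤ) = 2 * U + 1 := by rw [Int.toNat_of_nonneg (by omega)]; ring
    exact_mod_cast this
  have hUle : (U : ℝ) ≤ 2 * T / g := Int.floor_le _
  calc (#S : ℝ) ≤ #(Icc (-U) U) := by exact_mod_cast hcard
    _ = 2 * U + 1 := hcU
    _ ≤ 2 * (2 * T / g) + 1 := by linarith
    _ = 4 * T / g + 1 := by ring


/-! ### The number of `w` with `Re(w̄ z)` a square -/

/-- `W(z) = Σ_{M < m ≤ 2M} Σ_{|w|² = m} 𝔷(Re w̄ z)` for `z = r + is`: the number of pairs `(w, c)` with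
`M < |w|² ≤ 2M` and `c² = ur + vs = Re(w̄ z)` (`w = u + iv`). [cite: FriedlanderIwaniecAnnals1998, (5.16) proof] -/
def wCount (M : ℝ) (r s : ℤ) : ℕ :=
  ∑ m ∈ Ioc ⌊M⌋₊ ⌊2 * M⌋₊, ∑ uv ∈ sqPairs m, fiZeta (uv.1 * r + uv.2 * s)

/-- `𝔷(b) ≤ #{c ∈ I : c² = b}` for any `I` containing all square roots of `b`. [folklore] -/
theorem fiZeta_le_card_filter {b : ℤ} {I : Finset ℤ} (h : ∀ c : ℤ, c ^ 2 = b → c ∈ I) :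
    fiZeta b ≤ #(I.filter fun c => c ^ 2 = b) := by
  unfold fiZeta
  exact card_le_card fun c hc => mem_filter.mpr ⟨h c (mem_filter.mp hc).2, (mem_filter.mp hc).2⟩

/-- Cauchy–Schwarz in `ℤ²`: `(ur + vs)² ≤ (u² + v²)(r² + s²)`. [folklore] -/
theorem sq_lin_le (u v r s : ℤ) : (u * r + v * s) ^ 2 ≤ (u ^ 2 + v ^ 2) * (r ^ 2 + s ^ 2) := by
  nlinarith [sq_nonneg (u * s - v * r)]

/-- The fourth-root range for `c`: `c⁰ = ⌊(⌊2M⌋ (r² + s²))^{1/4}⌋`. [folklore] -/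
def cBound (M : ℝ) (r s : ℤ) : ℕ := Nat.sqrt (Nat.sqrt (⌊2 * M⌋₊ * (r ^ 2 + s ^ 2).toNat))

/-- If `c² = ur + vs` with `u² + v² ≤ ⌊2M⌋` then `|c| ≤ cBound`. [folklore] -/
theorem mem_Icc_cBound {M : ℝ} {r s c : ℤ} {uv : ℤ × ℤ} {m : ℕ} (huv : uv ∈ sqPairs m)
    (hm : m ≤ ⌊2 * M⌋₊) (hc : c ^ 2 = uv.1 * r + uv.2 * s) :
    c ∈ Icc (-(cBound M r s : ℤ)) (cBound M r s) := by
  unfold cBound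
  apply mem_Icc_sqrt_sqrt_of_pow_four_le
  have hn : ((r ^ 2 + s ^ 2).toNat : ℤ) = r ^ 2 + s ^ 2 := Int.toNat_of_nonneg (by positivity)
  have huv' := mem_sqPairs.mp huv
  push_cast
  rw [hn]
  calc c ^ 4 = (uv.1 * r + uv.2 * s) ^ 2 := by rw [← hc]; ring
    _ ≤ (uv.1 ^ 2 + uv.2 ^ 2) * (r ^ 2 + s ^ 2) := sq_lin_le _ _ _ _
    _ = (m : ℤ) * (r ^ 2 + s ^ 2) := by rw [huv']
    _ ≤ (⌊2 * M⌋₊ : ℕ) * (r ^ 2 + s ^ 2) := by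
        apply mul_le_mul_of_nonneg_right _ (by positivity); exact_mod_cast hm

/-- For fixed `c`, the `w` in the annulus with `Re(w̄ z) = c²` (all `m` at once). [folklore] -/
def wSlice (M : ℝ) (r s c : ℤ) : Finset (ℤ × ℤ) :=
  (Ioc ⌊M⌋₊ ⌊2 * M⌋₊).biUnion fun m => (sqPairs m).filter fun uv => uv.1 * r + uv.2 * s = c ^ 2

/-- `#wSlice ≤ 4 √(2M/(r²+s²)) + 1` for coprime `(r, s)` (points on a line in a disc). [folklore] -/
theorem card_wSlice_le {M : ℝ} (hM : 0 ≤ M) {r s : ℤ} (hcop : IsCoprime r s) (c : ℤ) :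
    (#(wSlice M r s c) : ℝ) ≤ 4 * Real.sqrt (2 * M / (r ^ 2 + s ^ 2 : ℤ)) + 1 := by
  obtain ⟨a, b, hab⟩ := hcop
  have hn : 0 < r ^ 2 + s ^ 2 := by
    by_contra h0
    have hr : r = 0 := by nlinarith [sq_nonneg r, sq_nonneg s]
    have hs : s = 0 := by nlinarith [sq_nonneg r, sq_nonneg s]
    rw [hr, hs] at hab; simp at hab
  have h := card_le_of_line_step hn Nat.one_pos (by positivity : (0 : ℝ) ≤ 2 * M) (wSlice M r s c)
    ?_ ?_
  · simpa using h
  · intro uv huv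
    obtain ⟨m, hm, huv⟩ := mem_biUnion.mp huv
    obtain ⟨huv, -⟩ := mem_filter.mp huv
    rw [mem_sqPairs.mp huv]
    have h1 : ((m : ℤ) : ℝ) ≤ ⌊2 * M⌋₊ := by exact_mod_cast (mem_Ioc.mp hm).2
    exact h1.trans (Nat.floor_le (by positivity))
  · intro uv huv uv' huv'
    obtain ⟨m, -, huv⟩ := mem_biUnion.mp huv
    obtain ⟨-, h1⟩ := mem_filter.mp huv
    obtain ⟨m', -, huv'⟩ := mem_biUnion.mp huv'
    obtain ⟨-, h2⟩ := mem_filter.mp huv'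
    obtain ⟨e1, e2⟩ := line_param hab (h1.trans h2.symm)
    exact ⟨_, one_dvd _, e1, e2⟩

/-- **`W(z) ≤ (2c⁰ + 1)(4√(2M/|z|²) + 1)`** for `z = r + is` with `(r, s) = 1`: given `c`, the `w`
with `Re(w̄ z) = c²` lie on a line at mutual distances `≥ |z|`. [cite: FriedlanderIwaniecAnnals1998, (5.16) proof] -/
theorem wCount_le {M : ℝ} (hM : 0 ≤ M) {r s : ℤ} (hcop : IsCoprime r s) :
    (wCount M r s : ℝ) ≤ (2 * cBound M r s + 1) * (4 * Real.sqrt (2 * M / (r ^ 2 + s ^ 2 : ℤ)) + 1) := by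
  classical
  set I : Finset ℤ := Icc (-(cBound M r s : ℤ)) (cBound M r s) with hI
  -- Step 1: `𝔷 ≤` the count of `c ∈ I`
  have h1 : wCount M r s ≤ ∑ m ∈ Ioc ⌊M⌋₊ ⌊2 * M⌋₊, ∑ uv ∈ sqPairs m,
      #(I.filter fun c => c ^ 2 = uv.1 * r + uv.2 * s) := by
    unfold wCount
    refine sum_le_sum fun m hm => sum_le_sum fun uv huv => fiZeta_le_card_filter fun c hc => ?_
    exact mem_Icc_cBound huv (mem_Ioc.mp hm).2 hc
  -- Step 2: exchange the order of summation
  have h2 : ∑ m ∈ Ioc ⌊M⌋₊ ⌊2 * M⌋₊, ∑ uv ∈ sqPairs m, #(I.filter fun c => c ^ 2 = uv.1 * r + uv.2 * s)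
      = ∑ c ∈ I, #(wSlice M r s c) := by
    have e : ∀ m ∈ Ioc ⌊M⌋₊ ⌊2 * M⌋₊, ∑ uv ∈ sqPairs m, #(I.filter fun c => c ^ 2 = uv.1 * r + uv.2 * s)
        = ∑ c ∈ I, #((sqPairs m).filter fun uv => uv.1 * r + uv.2 * s = c ^ 2) := by
      intro m _
      simp_rw [card_filter]
      rw [sum_comm]
      refine sum_congr rfl fun c _ => sum_congr rfl fun uv _ => ?_
      simp only [eq_comm]
    rw [sum_congr rfl e, sum_comm]
    refine sum_congr rfl fun c _ => ?_
    rw [wSlice, card_biUnion]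
    intro m _ m' _ hne
    simp only [Function.onFun]
    rw [Finset.disjoint_left]
    intro uv h h'
    have e1 := mem_sqPairs.mp (mem_filter.mp h).1
    have e2 := mem_sqPairs.mp (mem_filter.mp h').1
    exact hne (by exact_mod_cast e1.symm.trans e2)
  -- Step 3: bound each slice and count the `c`
  have h3 : (∑ c ∈ I, #(wSlice M r s c) : ℝ) ≤
      ∑ c ∈ I, (4 * Real.sqrt (2 * M / (r ^ 2 + s ^ 2 : ℤ)) + 1) :=
    sum_le_sum fun c _ => card_wSlice_le hM hcop c
  have hI : (#I : ℝ) = 2 * cBound M r s + 1 := by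
    rw [hI, Int.card_Icc]
    have : (((cBound M r s : ℤ) + 1 - -(cBound M r s : ℤ)).toNat : ℤ) = 2 * cBound M r s + 1 := by
      rw [Int.toNat_of_nonneg (by omega)]; ring
    exact_mod_cast this
  calc (wCount M r s : ℝ) ≤ (∑ m ∈ Ioc ⌊M⌋₊ ⌊2 * M⌋₊, ∑ uv ∈ sqPairs m,
        #(I.filter fun c => c ^ 2 = uv.1 * r + uv.2 * s) : ℕ) := by exact_mod_cast h1
    _ = (∑ c ∈ I, #(wSlice M r s c) : ℕ) := by rw [h2]
    _ ≤ ∑ c ∈ I, (4 * Real.sqrt (2 * M / (r ^ 2 + s ^ 2 : ℤ)) + 1) := by rw [Nat.cast_sum]; exact h3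
    _ = (2 * cBound M r s + 1) * (4 * Real.sqrt (2 * M / (r ^ 2 + s ^ 2 : ℤ)) + 1) := by
        rw [sum_const, nsmul_eq_mul, hI]


/-! ### Lattice points of a box in residue classes -/

/-- A residue class modulo `d` in each coordinate meets the box `[lo, hi] × [lo', hi']` in at most
`((hi-lo)/d + 1)((hi'-lo')/d + 1)` lattice points. [folklore] -/
theorem card_box_filter_dvd_sub_le {d : ℕ} (hd : 0 < d) (lo hi lo' hi' ν ν' : ℤ) :
    #((Icc lo hi ×ˢ Icc lo' hi').filter fun z : ℤ × ℤ => (d : ℤ) ∣ z.1 - ν ∧ (d : ℤ) ∣ z.2 - ν') ≤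
      ((hi - lo).toNat / d + 1) * ((hi' - lo').toNat / d + 1) := by
  rw [Finset.filter_product (s := Icc lo hi) (t := Icc lo' hi') (p := fun a : ℤ => (d : ℤ) ∣ a - ν)
    (q := fun b : ℤ => (d : ℤ) ∣ b - ν'), card_product]
  exact Nat.mul_le_mul (card_Icc_filter_dvd_sub_le' hd lo hi ν) (card_Icc_filter_dvd_sub_le' hd lo' hi' ν')

/-- `#{z ∈ [lo, hi] × [lo', hi'] : d ∣ |z|²} ≤ N(d) ((hi-lo)/d + 1)((hi'-lo')/d + 1)` with
`N(d) = pairCongrCount d` (fibre over `z mod d`). [folklore] -/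
theorem card_box_filter_dvd_normSq_le {d : ℕ} (hd : 0 < d) (lo hi lo' hi' : ℤ) :
    #((Icc lo hi ×ˢ Icc lo' hi').filter fun z : ℤ × ℤ => (d : ℤ) ∣ z.1 ^ 2 + z.2 ^ 2) ≤
      pairCongrCount d * (((hi - lo).toNat / d + 1) * ((hi' - lo').toNat / d + 1)) := by
  classical
  set s := (Icc lo hi ×ˢ Icc lo' hi').filter fun z : ℤ × ℤ => (d : ℤ) ∣ z.1 ^ 2 + z.2 ^ 2 with hs
  set f : ℤ × ℤ → ℕ × ℕ := fun z => ((z.1 % (d : ℤ)).toNat, (z.2 % (d : ℤ)).toNat) with hf_def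
  have hdz : (0 : ℤ) < d := by exact_mod_cast hd
  have hf1 : ∀ z : ℤ × ℤ, (((f z).1 : ℕ) : ℤ) = z.1 % (d : ℤ) := fun z =>
    Int.toNat_of_nonneg (Int.emod_nonneg _ hdz.ne')
  have hf2 : ∀ z : ℤ × ℤ, (((f z).2 : ℕ) : ℤ) = z.2 % (d : ℤ) := fun z =>
    Int.toNat_of_nonneg (Int.emod_nonneg _ hdz.ne')
  have hdvd1 : ∀ z : ℤ × ℤ, (d : ℤ) ∣ z.1 - ((f z).1 : ℕ) := fun z => by
    rw [hf1 z, Int.emod_def]; exact ⟨z.1 / d, by ring⟩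
  have hdvd2 : ∀ z : ℤ × ℤ, (d : ℤ) ∣ z.2 - ((f z).2 : ℕ) := fun z => by
    rw [hf2 z, Int.emod_def]; exact ⟨z.2 / d, by ring⟩
  have h1 : #s ≤ (((hi - lo).toNat / d + 1) * ((hi' - lo').toNat / d + 1)) * #(s.image f) := by
    refine card_le_mul_card_image s _ fun νν _ => ?_
    calc #(s.filter fun z => f z = νν)
        ≤ #((Icc lo hi ×ˢ Icc lo' hi').filter fun z : ℤ × ℤ =>
            (d : ℤ) ∣ z.1 - (νν.1 : ℕ) ∧ (d : ℤ) ∣ z.2 - (νν.2 : ℕ)) := by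
          refine card_le_card fun z hz => ?_
          obtain ⟨hzs, hfz⟩ := mem_filter.mp hz
          refine mem_filter.mpr ⟨(mem_filter.mp hzs).1, ?_⟩
          rw [← hfz]
          exact ⟨hdvd1 z, hdvd2 z⟩
      _ ≤ _ := card_box_filter_dvd_sub_le hd lo hi lo' hi' _ _
  have h2 : s.image f ⊆ ((range d) ×ˢ (range d)).filter fun ab => d ∣ ab.1 ^ 2 + ab.2 ^ 2 := by
    intro νν hνν
    obtain ⟨z, hz, rfl⟩ := mem_image.mp hνν
    obtain ⟨-, hdvd⟩ := mem_filter.mp hz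
    refine mem_filter.mpr ⟨mem_product.mpr ⟨mem_range.mpr ?_, mem_range.mpr ?_⟩, ?_⟩
    · have : (((f z).1 : ℕ) : ℤ) < d := by rw [hf1]; exact Int.emod_lt_of_pos _ hdz
      exact_mod_cast this
    · have : (((f z).2 : ℕ) : ℤ) < d := by rw [hf2]; exact Int.emod_lt_of_pos _ hdz
      exact_mod_cast this
    · have h : (d : ℤ) ∣ (((f z).1 : ℕ) : ℤ) ^ 2 + (((f z).2 : ℕ) : ℤ) ^ 2 := by
        obtain ⟨q1, hq1⟩ := hdvd1 z
        obtain ⟨q2, hq2⟩ := hdvd2 z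
        have e1 : (((f z).1 : ℕ) : ℤ) = z.1 - d * q1 := by linarith
        have e2 : (((f z).2 : ℕ) : ℤ) = z.2 - d * q2 := by linarith
        rw [e1, e2]
        have e : (z.1 - d * q1) ^ 2 + (z.2 - d * q2) ^ 2 =
            (z.1 ^ 2 + z.2 ^ 2) + d * (d * q1 ^ 2 - 2 * z.1 * q1 + d * q2 ^ 2 - 2 * z.2 * q2) := by ring
        rw [e]
        exact hdvd.add (dvd_mul_right _ _)
      exact_mod_cast h
  calc #s ≤ (((hi - lo).toNat / d + 1) * ((hi' - lo').toNat / d + 1)) * #(s.image f) := h1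
    _ ≤ (((hi - lo).toNat / d + 1) * ((hi' - lo').toNat / d + 1)) * pairCongrCount d :=
        Nat.mul_le_mul_left _ (card_le_card h2)
    _ = _ := mul_comm _ _

/-! ### Divisor sums over the lattice points of a box -/

/-- `|z|²` of a lattice point, as a natural number. [folklore] -/
def normSqNat (z : ℤ × ℤ) : ℕ := (z.1 ^ 2 + z.2 ^ 2).toNat

/-- `(normSqNat z : ℤ) = z.1² + z.2²`. [folklore] -/
theorem normSqNat_cast (z : ℤ × ℤ) : (normSqNat z : ℤ) = z.1 ^ 2 + z.2 ^ 2 :=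
  Int.toNat_of_nonneg (by positivity)

/-- The small moduli `d ≤ Y^{1/3}` (as `1 ≤ d ≤ Y`, `d³ ≤ Y`). [folklore] -/
def smallModuli (Y : ℕ) : Finset ℕ := (Icc 1 Y).filter fun d => d ^ 3 ≤ Y

/-- **Lemma 2.2 applied over a box**: for a box `B = [lo, hi] × [lo', hi']` and `Y` with `|z|² ≤ Y` on
the points considered,
`Σ_{z ∈ B, |z|² squarefree, |z|² ≤ Y} τ(|z|²) ≤ 9 Σ_{d ≤ Y^{1/3}} τ(d)² d ((hi-lo)/d + 1)((hi'-lo')/d + 1)`.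
[cite: FriedlanderIwaniecAnnals1998, (5.16) proof] -/
theorem sum_box_tau_le (lo hi lo' hi' : ℤ) (Y : ℕ) :
    ∑ z ∈ (Icc lo hi ×ˢ Icc lo' hi').filter (fun z => Squarefree (normSqNat z) ∧ normSqNat z ≤ Y),
        (#(normSqNat z).divisors : ℝ) ≤
      9 * ∑ d ∈ smallModuli Y, (#d.divisors : ℝ) ^ 2 * d *
        ((((hi - lo).toNat / d + 1) * ((hi' - lo').toNat / d + 1) : ℕ) : ℝ) := by
  classical
  set B := (Icc lo hi ×ˢ Icc lo' hi').filter (fun z => Squarefree (normSqNat z) ∧ normSqNat z ≤ Y)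
    with hB
  -- Lemma 2.2 pointwise
  have h1 : ∑ z ∈ B, (#(normSqNat z).divisors : ℝ) ≤
      ∑ z ∈ B, 9 * ∑ d ∈ smallDivisors (normSqNat z), (#d.divisors : ℝ) := by
    refine sum_le_sum fun z hz => ?_
    exact card_divisors_le_nine_mul_sum (mem_filter.mp hz).2.1
  -- exchange
  have h2 : ∑ z ∈ B, ∑ d ∈ smallDivisors (normSqNat z), (#d.divisors : ℝ) =
      ∑ d ∈ smallModuli Y, ∑ z ∈ B.filter (fun z => d ∈ smallDivisors (normSqNat z)),
        (#d.divisors : ℝ) := by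
    refine Finset.sum_comm' fun z d => ?_
    constructor
    swap
    · rintro ⟨hz, hd⟩
      exact ⟨(mem_filter.mp hz).1, (mem_filter.mp hz).2⟩
    · rintro ⟨hz, hd⟩
      refine ⟨mem_filter.mpr ⟨hz, hd⟩, ?_⟩
      obtain ⟨hdvd, hcube⟩ := mem_filter.mp hd
      have hY := (mem_filter.mp hz).2.2
      have hd0 := Nat.mem_divisors.mp hdvd
      refine mem_filter.mpr ⟨mem_Icc.mpr ⟨Nat.pos_of_dvd_of_pos hd0.1 (Nat.pos_of_ne_zero hd0.2), ?_⟩,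
        hcube.trans hY⟩
      exact (Nat.le_of_dvd (Nat.pos_of_ne_zero hd0.2) hd0.1).trans hY
  -- count each fibre
  have h3 : ∀ d ∈ smallModuli Y, #(B.filter fun z => d ∈ smallDivisors (normSqNat z)) ≤
      #d.divisors * d * (((hi - lo).toNat / d + 1) * ((hi' - lo').toNat / d + 1)) := by
    intro d hd
    have hd1 : 0 < d := (mem_Icc.mp (mem_filter.mp hd).1).1
    set F := B.filter fun z => d ∈ smallDivisors (normSqNat z) with hF
    rcases F.eq_empty_or_nonempty with hF0 | ⟨z₀, hz₀⟩
    · rw [hF0]; simp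
    · -- `d` is squarefree, being a divisor of a squarefree number
      have hdsq : Squarefree d := by
        obtain ⟨hzB, hdz⟩ := mem_filter.mp hz₀
        exact (mem_filter.mp hzB).2.1.squarefree_of_dvd (Nat.mem_divisors.mp (mem_filter.mp hdz).1).1
      calc #F ≤ #((Icc lo hi ×ˢ Icc lo' hi').filter fun z : ℤ × ℤ => (d : ℤ) ∣ z.1 ^ 2 + z.2 ^ 2) := by
            refine card_le_card fun z hz => ?_
            obtain ⟨hzB, hdz⟩ := mem_filter.mp hz
            refine mem_filter.mpr ⟨(mem_filter.mp hzB).1, ?_⟩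
            have h := (Nat.mem_divisors.mp (mem_filter.mp hdz).1).1
            rw [← normSqNat_cast]
            exact Int.natCast_dvd_natCast.mpr h
        _ ≤ pairCongrCount d * (((hi - lo).toNat / d + 1) * ((hi' - lo').toNat / d + 1)) :=
            card_box_filter_dvd_normSq_le hd1 _ _ _ _
        _ ≤ _ := Nat.mul_le_mul_right _ (pairCongrCount_le_of_squarefree d hdsq)
  calc ∑ z ∈ B, (#(normSqNat z).divisors : ℝ)
      ≤ ∑ z ∈ B, 9 * ∑ d ∈ smallDivisors (normSqNat z), (#d.divisors : ℝ) := h1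
    _ = 9 * ∑ d ∈ smallModuli Y, ∑ z ∈ B.filter (fun z => d ∈ smallDivisors (normSqNat z)),
        (#d.divisors : ℝ) := by rw [← mul_sum, h2]
    _ = 9 * ∑ d ∈ smallModuli Y, (#d.divisors : ℝ) *
        #(B.filter fun z => d ∈ smallDivisors (normSqNat z)) := by
        congr 1; refine sum_congr rfl fun d _ => ?_; rw [sum_const, nsmul_eq_mul, mul_comm]
    _ ≤ 9 * ∑ d ∈ smallModuli Y, (#d.divisors : ℝ) *
        ((#d.divisors * d * (((hi - lo).toNat / d + 1) * ((hi' - lo').toNat / d + 1)) : ℕ) : ℝ) := by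
        gcongr with d hd
        exact_mod_cast h3 d hd
    _ = _ := by
        congr 1; refine sum_congr rfl fun d _ => ?_; push_cast; ring


/-! ### A polar box lies in a small square -/

/-- `√(1 + θ) ≤ 1 + θ/2` for `θ ≥ 0`. [folklore] -/
theorem sqrt_one_add_le {θ : ℝ} (hθ : 0 ≤ θ) : Real.sqrt (1 + θ) ≤ 1 + θ / 2 := by
  rw [Real.sqrt_le_left (by linarith)]
  nlinarith

/-- The modulus of a Gaussian integer as a complex number: `‖z‖² = N(z)`. [folklore] -/
theorem norm_toComplex_sq (z : GaussianInt) : ‖GaussianInt.toComplex z‖ ^ 2 = (z.norm : ℝ) := by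
  rw [← Complex.normSq_eq_norm_sq, GaussianInt.intCast_real_norm]

/-- **The polar box `N' < |z|² ≤ (1+θ)N'`, `φ < arg z ≤ φ + 2πθ (mod 2π)` lies in the square of
half-side `9θ√N'` centred at `√N' e^{iφ}`** (for `0 < θ ≤ 1/2`). [folklore] -/
theorem polarBox_subset {N' θ φ : ℝ} (hθ : 0 < θ) (hθ1 : θ ≤ 1 / 2) {z : GaussianInt}
    (hz1 : N' < (z.norm : ℝ)) (hz2 : (z.norm : ℝ) ≤ (1 + θ) * N')
    (harg : ∃ k : ℤ, φ < gaussArg z - 2 * π * k ∧ gaussArg z - 2 * π * k ≤ φ + 2 * π * θ) :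
    |(z.re : ℝ) - Real.sqrt N' * Real.cos φ| ≤ 9 * θ * Real.sqrt N' ∧
      |(z.im : ℝ) - Real.sqrt N' * Real.sin φ| ≤ 9 * θ * Real.sqrt N' := by
  obtain ⟨k, hk1, hk2⟩ := harg
  set ρ : ℝ := ‖GaussianInt.toComplex z‖ with hρ
  set ψ : ℝ := gaussArg z - 2 * π * k with hψ
  have hρ0 : 0 ≤ ρ := norm_nonneg _
  have hρsq : ρ ^ 2 = (z.norm : ℝ) := norm_toComplex_sq z
  have hsN : 0 ≤ Real.sqrt N' := Real.sqrt_nonneg _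
  -- `√N' ≤ ρ ≤ (1 + θ/2) √N'`
  have hρ1 : Real.sqrt N' ≤ ρ := by
    rw [← Real.sqrt_sq hρ0]; exact Real.sqrt_le_sqrt (by linarith)
  have hρ2 : ρ ≤ (1 + θ / 2) * Real.sqrt N' := by
    have h1 : ρ ≤ Real.sqrt ((1 + θ) * N') := by
      rw [← Real.sqrt_sq hρ0]; exact Real.sqrt_le_sqrt (by linarith)
    rw [Real.sqrt_mul (by linarith)] at h1
    exact h1.trans (mul_le_mul_of_nonneg_right (sqrt_one_add_le hθ.le) hsN)
  -- the coordinates through `ρ` and `ψ`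
  have hre : (z.re : ℝ) = ρ * Real.cos ψ := by
    have h := Complex.norm_mul_cos_arg (GaussianInt.toComplex z)
    rw [← GaussianInt.intCast_re] at h
    rw [hψ, gaussArg_def, show Complex.arg (GaussianInt.toComplex z) - 2 * π * k =
      Complex.arg (GaussianInt.toComplex z) + (-k : ℤ) * (2 * π) by push_cast; ring,
      Real.cos_add_int_mul_two_pi, ← h]
  have him : (z.im : ℝ) = ρ * Real.sin ψ := by
    have h := Complex.norm_mul_sin_arg (GaussianInt.toComplex z)
    rw [← GaussianInt.intCast_im] at h
    rw [hψ, gaussArg_def, show Complex.arg (GaussianInt.toComplex z) - 2 * π * k =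
      Complex.arg (GaussianInt.toComplex z) + (-k : ℤ) * (2 * π) by push_cast; ring,
      Real.sin_add_int_mul_two_pi, ← h]
  have hψφ : |ψ - φ| ≤ 2 * π * θ := by rw [abs_le]; constructor <;> linarith
  have hcos : |Real.cos ψ - Real.cos φ| ≤ 2 * π * θ := (Real.abs_cos_sub_cos_le ψ φ).trans hψφ
  have hsin : |Real.sin ψ - Real.sin φ| ≤ 2 * π * θ := (Real.abs_sin_sub_sin_le ψ φ).trans hψφ
  have hπ : π ≤ 3.15 := Real.pi_lt_d2.le
  have key : ∀ (c c' : ℝ), |c'| ≤ 1 → |c - c'| ≤ 2 * π * θ →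
      |ρ * c - Real.sqrt N' * c'| ≤ 9 * θ * Real.sqrt N' := by
    intro c c' hc' hcc'
    have e : ρ * c - Real.sqrt N' * c' = ρ * (c - c') + (ρ - Real.sqrt N') * c' := by ring
    rw [e]
    calc |ρ * (c - c') + (ρ - Real.sqrt N') * c'|
        ≤ |ρ * (c - c')| + |(ρ - Real.sqrt N') * c'| := abs_add_le _ _
      _ = ρ * |c - c'| + (ρ - Real.sqrt N') * |c'| := by
          rw [abs_mul, abs_mul, abs_of_nonneg hρ0, abs_of_nonneg (sub_nonneg.mpr hρ1)]
      _ ≤ (1 + θ / 2) * Real.sqrt N' * (2 * π * θ) + (θ / 2 * Real.sqrt N') * 1 :=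
          add_le_add (mul_le_mul hρ2 hcc' (abs_nonneg _) (by positivity))
            (mul_le_mul (by linarith) hc' (abs_nonneg _) (mul_nonneg (by linarith) hsN))
      _ = θ * Real.sqrt N' * (2 * π * (1 + θ / 2) + 1 / 2) := by ring
      _ ≤ θ * Real.sqrt N' * 9 := by
          apply mul_le_mul_of_nonneg_left _ (by positivity)
          nlinarith
      _ = 9 * θ * Real.sqrt N' := by ring
  refine ⟨?_, ?_⟩
  · rw [hre]; exact key _ _ (Real.abs_cos_le_one φ) hcos
  · rw [him]; exact key _ _ (Real.abs_sin_le_one φ) hsin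

/-- Integer form: the coordinates lie in `[⌈c - R⌉, ⌊c + R⌋]`. [folklore] -/
theorem mem_Icc_of_abs_sub_le {a : ℤ} {c R : ℝ} (h : |(a : ℝ) - c| ≤ R) :
    a ∈ Icc ⌈c - R⌉ ⌊c + R⌋ := by
  rw [abs_le] at h
  rw [mem_Icc, Int.ceil_le, Int.le_floor]
  constructor <;> linarith [h.1, h.2]

/-- The length of `[⌈c - R⌉, ⌊c + R⌋]` is at most `2R`. [folklore] -/
theorem toNat_floor_sub_ceil_le {c R : ℝ} (hR : 0 ≤ R) :
    ((⌊c + R⌋ - ⌈c - R⌉).toNat : ℝ) ≤ 2 * R := by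
  have h1 : ((⌊c + R⌋ : ℤ) : ℝ) ≤ c + R := Int.floor_le _
  have h2 : c - R ≤ ((⌈c - R⌉ : ℤ) : ℝ) := Int.le_ceil _
  rcases le_or_gt 0 (⌊c + R⌋ - ⌈c - R⌉) with h | h
  · have : (((⌊c + R⌋ - ⌈c - R⌉).toNat : ℤ) : ℝ) = ((⌊c + R⌋ : ℤ) : ℝ) - ((⌈c - R⌉ : ℤ) : ℝ) := by
      rw [Int.toNat_of_nonneg h]; push_cast; ring
    have e : (((⌊c + R⌋ - ⌈c - R⌉).toNat : ℤ) : ℝ) = (((⌊c + R⌋ - ⌈c - R⌉).toNat : ℕ) : ℝ) := rfl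
    rw [← e, this]; linarith
  · rw [Int.toNat_of_nonpos h.le]; simp; positivity


/-! ### The trivial bound: reduction to lattice-point counts -/

/-- `N(z) = re² + im²`. [folklore] -/
theorem norm_eq_sq_add_sq (z : GaussianInt) : z.norm = z.re ^ 2 + z.im ^ 2 := by
  rw [Zsqrtd.norm_def]; ring

/-- `Re(w̄ z) = ur + vs` for `w = u + iv`, `z = r + is`. [folklore] -/
theorem re_star_toGauss_mul (uv : ℤ × ℤ) (z : GaussianInt) :
    (star (toGauss uv) * z).re = uv.1 * z.re + uv.2 * z.im := by
  simp only [toGauss, Zsqrtd.re_mul, Zsqrtd.re_star, Zsqrtd.im_star]; ring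

/-- A Gaussian integer of squarefree norm is primitive: `(re, im) = 1`. [folklore] -/
theorem isCoprime_re_im_of_squarefree {z : GaussianInt} {n : ℕ} (hz : z.norm = n)
    (hn : Squarefree n) : IsCoprime z.re z.im := by
  rw [Int.isCoprime_iff_gcd_eq_one]
  set g : ℕ := Int.gcd z.re z.im with hg
  have h1 : (g : ℤ) ∣ z.re := Int.gcd_dvd_left z.re z.im
  have h2 : (g : ℤ) ∣ z.im := Int.gcd_dvd_right z.re z.im
  have h3 : ((g * g : ℕ) : ℤ) ∣ (n : ℤ) := by
    rw [← hz, norm_eq_sq_add_sq]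
    push_cast
    exact dvd_add (by rw [sq]; exact mul_dvd_mul h1 h1) (by rw [sq]; exact mul_dvd_mul h2 h2)
  have h4 : g * g ∣ n := Int.natCast_dvd_natCast.mp h3
  exact Nat.isUnit_iff.mp (hn g h4)

/-- `β(n) ≠ 0` forces `n` squarefree (the factor `μ(n)`). [folklore] -/
theorem squarefree_of_fiBeta_ne_zero {p : ℝ → ℝ} {C P τ : ℝ} {n : ℕ} (h : fiBeta p C P τ n ≠ 0) :
    Squarefree n := by
  rw [fiBeta_def] at h
  split_ifs at h with hc
  · have hμ : (μ n : ℝ) ≠ 0 := fun h0 => h (by rw [h0]; ring)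
    exact ArithmeticFunction.moebius_ne_zero_iff_squarefree.mp (by exact_mod_cast hμ)
  · exact absurd rfl h

/-- `|β(n)| ≤ τ(n)` when `|p| ≤ 1`. [folklore] -/
theorem abs_fiBeta_le_card_divisors {p : ℝ → ℝ} (hp1 : ∀ u, |p u| ≤ 1) (C P τ : ℝ) (n : ℕ) :
    |fiBeta p C P τ n| ≤ #n.divisors := by
  have h := abs_fiBeta_le p C P τ n
  rw [ArithmeticFunction.sigma_zero_apply] at h
  calc |fiBeta p C P τ n| ≤ |p n| * (#n.divisors : ℕ) := h
    _ ≤ 1 * (#n.divisors : ℕ) := mul_le_mul_of_nonneg_right (hp1 _) (Nat.cast_nonneg _)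
    _ = #n.divisors := one_mul _

/-- The upper end `Y = ⌊(1+θ)N'⌋` of the segment (4.12) `N' < n ≤ (1+θ)N'`.
[cite: FriedlanderIwaniecAnnals1998, (4.12)] -/
def secY (θ N' : ℝ) : ℕ := ⌊(1 + θ) * N'⌋₊

/-- The uniform `w`-count `W = (2⌊(⌊2M⌋Y)^{1/4}⌋ + 1)(4√(2M/N') + 1)` of the trivial bound.
[cite: FriedlanderIwaniecAnnals1998, (5.16) proof] -/
def secW (M θ N' : ℝ) : ℝ :=
  (2 * (Nat.sqrt (Nat.sqrt (⌊2 * M⌋₊ * secY θ N')) : ℝ) + 1) * (4 * Real.sqrt (2 * M / N') + 1)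

/-- The side `L = ⌊18 θ √N'⌋` of the integer square containing a polar box.
[cite: FriedlanderIwaniecAnnals1998, (5.14)] -/
def secL (θ N' : ℝ) : ℕ := ⌊18 * θ * Real.sqrt N'⌋₊

/-- The divisor sum `Σ_{d ≤ Y^{1/3}} τ(d)² d (⌊L/d⌋ + 1)²` bounding `Σ_{z ∈ square of side L} τ(|z|²)`
over squarefree `|z|² ≤ Y`. [cite: FriedlanderIwaniecAnnals1998, (5.16) proof] -/
def boxDivSum (L Y : ℕ) : ℝ :=
  ∑ d ∈ smallModuli Y, (#d.divisors : ℝ) ^ 2 * d * ((L / d + 1 : ℕ) : ℝ) ^ 2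

/-- `W ≥ 0`. [folklore] -/
theorem secW_nonneg (M θ N' : ℝ) : 0 ≤ secW M θ N' := by unfold secW; positivity

/-- Uniformity of the `w`-count over the box: for `z = r + is` primitive with `N' < r² + s² ≤ Y`,
`W(z) ≤ W`. [folklore] -/
theorem wCount_le_secW {M θ N' : ℝ} (hM : 0 ≤ M) (hN' : 0 < N') {r s : ℤ} (hcop : IsCoprime r s)
    (h1 : N' ≤ ((r ^ 2 + s ^ 2 : ℤ) : ℝ)) (h2 : (r ^ 2 + s ^ 2).toNat ≤ secY θ N') :
    (wCount M r s : ℝ) ≤ secW M θ N' := by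
  have h := wCount_le hM hcop
  unfold secW
  refine h.trans (mul_le_mul ?_ ?_ (by positivity) (by positivity))
  · have : cBound M r s ≤ Nat.sqrt (Nat.sqrt (⌊2 * M⌋₊ * secY θ N')) := by
      unfold cBound
      exact Nat.sqrt_le_sqrt (Nat.sqrt_le_sqrt (Nat.mul_le_mul_left _ h2))
    have : (cBound M r s : ℝ) ≤ Nat.sqrt (Nat.sqrt (⌊2 * M⌋₊ * secY θ N')) := by exact_mod_cast this
    linarith
  · have hn : (0 : ℝ) < ((r ^ 2 + s ^ 2 : ℤ) : ℝ) := hN'.trans_le h1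
    have : Real.sqrt (2 * M / (r ^ 2 + s ^ 2 : ℤ)) ≤ Real.sqrt (2 * M / N') :=
      Real.sqrt_le_sqrt (div_le_div_of_nonneg_left (by positivity) hN' h1)
    linarith

/-- **Step 1 of (5.16)**: `‖B(M, N)‖ ≤ Σ_n |β(n)| Σ_{z} |q(arg z)| W(z)` (triangle inequality and
`Σ_w 𝔷(Re w̄ z) = W(z)`), for `|α| ≤ 1`. [cite: FriedlanderIwaniecAnnals1998, (5.16) proof] -/
theorem norm_fiGaussSector_le_sum_wCount {α : ℕ → ℂ} (hα : ∀ m, ‖α m‖ ≤ 1) (q p : ℝ → ℝ)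
    (z₀ : GaussianInt) (M N' θ C P τ : ℝ) :
    ‖fiGaussSector α q p z₀ M N' θ C P τ‖ ≤
      ∑ n ∈ Ioc ⌊N'⌋₊ ⌊(1 + θ) * N'⌋₊, |fiBeta p C P τ n| *
        ∑ z ∈ (primaryNormEq n).filter (GaussCongrEight z₀),
          |q (gaussArg z)| * (wCount M z.re z.im : ℝ) := by
  set Rm := Ioc ⌊M⌋₊ ⌊2 * M⌋₊ with hRm
  set S := Ioc ⌊N'⌋₊ ⌊(1 + θ) * N'⌋₊ with hS
  set PF : ℕ → Finset GaussianInt := fun n => (primaryNormEq n).filter (GaussCongrEight z₀) with hPF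
  -- Step 0: triangle inequality
  have h0 : ‖fiGaussSector α q p z₀ M N' θ C P τ‖ ≤ ∑ m ∈ Rm, ∑ n ∈ S, |fiBeta p C P τ n| *
      ∑ uv ∈ sqPairs m, ∑ z ∈ PF n, |q (gaussArg z)| * (fiZeta (star (toGauss uv) * z).re : ℝ) := by
    rw [fiGaussSector_def]
    refine (norm_sum_le _ _).trans (sum_le_sum fun m _ => ?_)
    refine (norm_sum_le _ _).trans (sum_le_sum fun n _ => ?_)
    rw [norm_mul, norm_mul, Complex.norm_real, Complex.norm_real, Real.norm_eq_abs, Real.norm_eq_abs]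
    have hin : |∑ uv ∈ sqPairs m, ∑ z ∈ PF n, q (gaussArg z) * (fiZeta (star (toGauss uv) * z).re : ℝ)|
        ≤ ∑ uv ∈ sqPairs m, ∑ z ∈ PF n, |q (gaussArg z)| * (fiZeta (star (toGauss uv) * z).re : ℝ) := by
      refine (abs_sum_le_sum_abs _ _).trans (sum_le_sum fun uv _ => ?_)
      refine (abs_sum_le_sum_abs _ _).trans (sum_le_sum fun z _ => ?_)
      rw [abs_mul, Nat.abs_cast]
    calc ‖α m‖ * |fiBeta p C P τ n| *
          |∑ uv ∈ sqPairs m, ∑ z ∈ PF n, q (gaussArg z) * (fiZeta (star (toGauss uv) * z).re : ℝ)|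
        ≤ 1 * |fiBeta p C P τ n| *
          ∑ uv ∈ sqPairs m, ∑ z ∈ PF n, |q (gaussArg z)| * (fiZeta (star (toGauss uv) * z).re : ℝ) := by
          gcongr
          exact hα m
      _ = _ := by rw [one_mul]
  -- Step 1: exchange the sums, `Σ_m Σ_{|w|²=m} 𝔷 = W(z)`
  have h1 : ∑ m ∈ Rm, ∑ n ∈ S, |fiBeta p C P τ n| *
      ∑ uv ∈ sqPairs m, ∑ z ∈ PF n, |q (gaussArg z)| * (fiZeta (star (toGauss uv) * z).re : ℝ) =
      ∑ n ∈ S, |fiBeta p C P τ n| * ∑ z ∈ PF n, |q (gaussArg z)| * (wCount M z.re z.im : ℝ) := by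
    rw [sum_comm]
    refine sum_congr rfl fun n _ => ?_
    rw [← mul_sum]
    congr 1
    have e : ∀ m ∈ Rm, ∑ uv ∈ sqPairs m, ∑ z ∈ PF n,
        |q (gaussArg z)| * (fiZeta (star (toGauss uv) * z).re : ℝ) =
        ∑ z ∈ PF n, ∑ uv ∈ sqPairs m, |q (gaussArg z)| * (fiZeta (uv.1 * z.re + uv.2 * z.im) : ℝ) := by
      intro m _
      rw [sum_comm]
      refine sum_congr rfl fun z _ => sum_congr rfl fun uv _ => ?_
      rw [re_star_toGauss_mul]
    rw [sum_congr rfl e, sum_comm]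
    refine sum_congr rfl fun z _ => ?_
    rw [wCount, Nat.cast_sum]
    rw [mul_sum]
    refine sum_congr rfl fun m _ => ?_
    rw [Nat.cast_sum, mul_sum]
  exact h0.trans h1.le


/-- **Step 2 of (5.16)**: the `z`-sum is a divisor sum over the lattice points of the square around
the polar box: `Σ_n |β(n)| Σ_z |q(arg z)| W(z) ≤ W · Σ_{z ∈ square, |z|² squarefree ≤ Y} τ(|z|²)`.
[cite: FriedlanderIwaniecAnnals1998, (5.16) proof] -/
theorem sum_wCount_le_secW_mul_boxSum {q p : ℝ → ℝ} (hq1 : ∀ u, |q u| ≤ 1) (hp1 : ∀ u, |p u| ≤ 1)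
    {θ φ : ℝ} (hθ : 0 < θ) (hθ1 : θ ≤ 1 / 2)
    (hqs : ∀ u, q u ≠ 0 → ∃ k : ℤ, φ < u - 2 * π * k ∧ u - 2 * π * k ≤ φ + 2 * π * θ)
    {M N' : ℝ} (hM : 0 ≤ M) (hN' : 0 < N') (z₀ : GaussianInt) (C P τ : ℝ) :
    ∑ n ∈ Ioc ⌊N'⌋₊ ⌊(1 + θ) * N'⌋₊, |fiBeta p C P τ n| *
        ∑ z ∈ (primaryNormEq n).filter (GaussCongrEight z₀), |q (gaussArg z)| * (wCount M z.re z.im : ℝ) ≤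
      secW M θ N' * ∑ zz ∈ (Icc ⌈Real.sqrt N' * Real.cos φ - 9 * θ * Real.sqrt N'⌉
          ⌊Real.sqrt N' * Real.cos φ + 9 * θ * Real.sqrt N'⌋ ×ˢ
        Icc ⌈Real.sqrt N' * Real.sin φ - 9 * θ * Real.sqrt N'⌉
          ⌊Real.sqrt N' * Real.sin φ + 9 * θ * Real.sqrt N'⌋).filter
          (fun zz => Squarefree (normSqNat zz) ∧ normSqNat zz ≤ secY θ N'),
        (#(normSqNat zz).divisors : ℝ) := by
  classical
  set S := Ioc ⌊N'⌋₊ ⌊(1 + θ) * N'⌋₊ with hS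
  set PF : ℕ → Finset GaussianInt := fun n => (primaryNormEq n).filter (GaussCongrEight z₀) with hPF
  set R : ℝ := 9 * θ * Real.sqrt N' with hR
  set cφ : ℝ := Real.sqrt N' * Real.cos φ with hcφ
  set sφ : ℝ := Real.sqrt N' * Real.sin φ with hsφ
  set Box := Icc ⌈cφ - R⌉ ⌊cφ + R⌋ ×ˢ Icc ⌈sφ - R⌉ ⌊sφ + R⌋ with hBox
  set BoxF := Box.filter (fun zz => Squarefree (normSqNat zz) ∧ normSqNat zz ≤ secY θ N') with hBoxF
  have hSY : ∀ n ∈ S, n ≤ secY θ N' := fun n hn => (mem_Ioc.mp hn).2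
  have hSN : ∀ n ∈ S, N' < (n : ℝ) := fun n hn => by
    have h := (mem_Ioc.mp hn).1
    have : (⌊N'⌋₊ : ℝ) + 1 ≤ n := by exact_mod_cast h
    linarith [Nat.lt_floor_add_one N']
  have hSN2 : ∀ n ∈ S, (n : ℝ) ≤ (1 + θ) * N' := fun n hn => by
    have h := (mem_Ioc.mp hn).2
    have : (n : ℝ) ≤ ⌊(1 + θ) * N'⌋₊ := by exact_mod_cast h
    exact this.trans (Nat.floor_le (by positivity))
  -- Step 2: termwise bound
  have h2 : ∀ n ∈ S, ∀ z ∈ PF n, |fiBeta p C P τ n| * (|q (gaussArg z)| * (wCount M z.re z.im : ℝ)) ≤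
      secW M θ N' * (if Squarefree n ∧ q (gaussArg z) ≠ 0 then (#n.divisors : ℝ) else 0) := by
    intro n hn z hz
    have hzn : z.norm = n := (mem_primaryNormEq.mp (mem_filter.mp hz).1).1
    by_cases hb : fiBeta p C P τ n = 0
    · rw [hb, abs_zero, zero_mul]
      exact mul_nonneg (secW_nonneg _ _ _) (by split_ifs <;> positivity)
    by_cases hq0 : q (gaussArg z) = 0
    · rw [hq0, abs_zero, zero_mul, mul_zero]
      exact mul_nonneg (secW_nonneg _ _ _) (by split_ifs <;> positivity)
    have hsq := squarefree_of_fiBeta_ne_zero hb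
    rw [if_pos ⟨hsq, hq0⟩]
    have hcop := isCoprime_re_im_of_squarefree hzn hsq
    have hzn' : z.re ^ 2 + z.im ^ 2 = (n : ℤ) := by rw [← norm_eq_sq_add_sq, hzn]
    have hW : (wCount M z.re z.im : ℝ) ≤ secW M θ N' := by
      refine wCount_le_secW hM hN' hcop ?_ ?_
      · rw [hzn']; push_cast; exact (hSN n hn).le
      · rw [hzn']; exact (hSY n hn)
    calc |fiBeta p C P τ n| * (|q (gaussArg z)| * (wCount M z.re z.im : ℝ))
        ≤ (#n.divisors : ℝ) * (1 * secW M θ N') := by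
          refine mul_le_mul (abs_fiBeta_le_card_divisors hp1 C P τ n)
            (mul_le_mul (hq1 _) hW (by positivity) zero_le_one) (by positivity) (by positivity)
      _ = secW M θ N' * (#n.divisors : ℝ) := by ring
  -- Step 3: sum the termwise bound
  have h3 : ∑ n ∈ S, |fiBeta p C P τ n| * ∑ z ∈ PF n, |q (gaussArg z)| * (wCount M z.re z.im : ℝ) ≤
      secW M θ N' * ∑ n ∈ S.filter Squarefree,
        ∑ z ∈ (primaryNormEq n).filter (fun z => q (gaussArg z) ≠ 0), (#n.divisors : ℝ) := by
    calc ∑ n ∈ S, |fiBeta p C P τ n| * ∑ z ∈ PF n, |q (gaussArg z)| * (wCount M z.re z.im : ℝ)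
        = ∑ n ∈ S, ∑ z ∈ PF n, |fiBeta p C P τ n| * (|q (gaussArg z)| * (wCount M z.re z.im : ℝ)) := by
          refine sum_congr rfl fun n _ => ?_; rw [mul_sum]
      _ ≤ ∑ n ∈ S, ∑ z ∈ PF n,
          secW M θ N' * (if Squarefree n ∧ q (gaussArg z) ≠ 0 then (#n.divisors : ℝ) else 0) :=
          sum_le_sum fun n hn => sum_le_sum fun z hz => h2 n hn z hz
      _ = secW M θ N' * ∑ n ∈ S, ∑ z ∈ PF n,
          (if Squarefree n ∧ q (gaussArg z) ≠ 0 then (#n.divisors : ℝ) else 0) := by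
          rw [mul_sum]; refine sum_congr rfl fun n _ => ?_; rw [mul_sum]
      _ ≤ secW M θ N' * ∑ n ∈ S.filter Squarefree,
          ∑ z ∈ (primaryNormEq n).filter (fun z => q (gaussArg z) ≠ 0), (#n.divisors : ℝ) := by
          refine mul_le_mul_of_nonneg_left ?_ (secW_nonneg _ _ _)
          rw [sum_filter]
          refine sum_le_sum fun n _ => ?_
          split_ifs with hsq
          · calc ∑ z ∈ PF n, (if Squarefree n ∧ q (gaussArg z) ≠ 0 then (#n.divisors : ℝ) else 0)
                = ∑ z ∈ PF n, (if q (gaussArg z) ≠ 0 then (#n.divisors : ℝ) else 0) := by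
                  refine sum_congr rfl fun z _ => ?_; simp [hsq]
              _ ≤ ∑ z ∈ primaryNormEq n, (if q (gaussArg z) ≠ 0 then (#n.divisors : ℝ) else 0) :=
                  sum_le_sum_of_subset_of_nonneg (filter_subset _ _) fun z _ _ => by
                    split_ifs <;> positivity
              _ = ∑ z ∈ (primaryNormEq n).filter (fun z => q (gaussArg z) ≠ 0), (#n.divisors : ℝ) :=
                  (sum_filter _ _).symm
          · refine (sum_congr rfl fun z _ => ?_).trans_le (le_of_eq sum_const_zero)
            simp [hsq]
  -- Step 4: inject `(n, z) ↦ (re z, im z)` into the square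
  have h4 : ∑ n ∈ S.filter Squarefree,
      ∑ z ∈ (primaryNormEq n).filter (fun z => q (gaussArg z) ≠ 0), (#n.divisors : ℝ) ≤
      ∑ zz ∈ BoxF, (#(normSqNat zz).divisors : ℝ) := by
    rw [sum_sigma']
    set Sg := (S.filter Squarefree).sigma fun n => (primaryNormEq n).filter (fun z => q (gaussArg z) ≠ 0)
      with hSg
    set e : (Σ _ : ℕ, GaussianInt) → ℤ × ℤ := fun x => (x.2.re, x.2.im) with he
    have hmem : ∀ x ∈ Sg, x.1 ∈ S ∧ Squarefree x.1 ∧ x.2.norm = x.1 ∧ q (gaussArg x.2) ≠ 0 := by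
      intro x hx
      obtain ⟨hn, hz⟩ := mem_sigma.mp hx
      obtain ⟨hz1, hz2⟩ := mem_filter.mp hz
      exact ⟨(mem_filter.mp hn).1, (mem_filter.mp hn).2, (mem_primaryNormEq.mp hz1).1, hz2⟩
    have hnsq : ∀ x ∈ Sg, normSqNat (e x) = x.1 := by
      intro x hx
      obtain ⟨-, -, hzn, -⟩ := hmem x hx
      have : (normSqNat (e x) : ℤ) = x.1 := by
        rw [normSqNat_cast, ← hzn, norm_eq_sq_add_sq]
      exact_mod_cast this
    have hinj : ∀ x ∈ Sg, ∀ y ∈ Sg, e x = e y → x = y := by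
      intro x hx y hy hxy
      simp only [he, Prod.mk.injEq] at hxy
      have h2 : x.2 = y.2 := Zsqrtd.ext hxy.1 hxy.2
      have h1 : x.1 = y.1 := by
        have ex := (hmem x hx).2.2.1
        have ey := (hmem y hy).2.2.1
        rw [h2] at ex
        exact_mod_cast ex.symm.trans ey
      exact Sigma.ext h1 (heq_of_eq h2)
    calc ∑ x ∈ Sg, (#(x.1).divisors : ℝ) = ∑ x ∈ Sg, (#(normSqNat (e x)).divisors : ℝ) := by
          refine sum_congr rfl fun x hx => ?_; rw [hnsq x hx]
      _ = ∑ zz ∈ Sg.image e, (#(normSqNat zz).divisors : ℝ) := by rw [sum_image hinj]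
      _ ≤ ∑ zz ∈ BoxF, (#(normSqNat zz).divisors : ℝ) := by
          refine sum_le_sum_of_subset_of_nonneg ?_ fun _ _ _ => by positivity
          intro zz hzz
          obtain ⟨x, hx, rfl⟩ := mem_image.mp hzz
          obtain ⟨hn, hsq, hzn, hq0⟩ := hmem x hx
          have hzR1 : N' < (x.2.norm : ℝ) := by rw [hzn]; exact_mod_cast hSN x.1 hn
          have hzR2 : (x.2.norm : ℝ) ≤ (1 + θ) * N' := by rw [hzn]; exact_mod_cast hSN2 x.1 hn
          obtain ⟨bre, bim⟩ := polarBox_subset hθ hθ1 hzR1 hzR2 (hqs _ hq0)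
          refine mem_filter.mpr ⟨mem_product.mpr ⟨mem_Icc_of_abs_sub_le bre, mem_Icc_of_abs_sub_le bim⟩,
            ?_, ?_⟩
          · rw [hnsq x hx]; exact hsq
          · rw [hnsq x hx]; exact hSY x.1 hn
  calc _ ≤ _ := h3
    _ ≤ _ := mul_le_mul_of_nonneg_left h4 (secW_nonneg _ _ _)

/-- **FI (5.16), combinatorial form**: for `|α| ≤ 1`, `|p| ≤ 1`, `|q| ≤ 1` with `q` supported on the
sector `φ < u ≤ φ + 2πθ (mod 2π)`, `0 < θ ≤ 1/2`, `M ≥ 0`, `N' > 0`: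
`‖B(M, N)‖ ≤ W · 9 Σ_{d ≤ Y^{1/3}} τ(d)² d (⌊L/d⌋ + 1)²` (`secW`, `boxDivSum`).
[cite: FriedlanderIwaniecAnnals1998, (5.16)] -/
theorem norm_fiGaussSector_le_secW_mul_boxDivSum {α : ℕ → ℂ} (hα : ∀ m, ‖α m‖ ≤ 1) {q p : ℝ → ℝ}
    (hq1 : ∀ u, |q u| ≤ 1) (hp1 : ∀ u, |p u| ≤ 1) {θ φ : ℝ} (hθ : 0 < θ) (hθ1 : θ ≤ 1 / 2)
    (hqs : ∀ u, q u ≠ 0 → ∃ k : ℤ, φ < u - 2 * π * k ∧ u - 2 * π * k ≤ φ + 2 * π * θ)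
    {M N' : ℝ} (hM : 0 ≤ M) (hN' : 0 < N') (z₀ : GaussianInt) (C P τ : ℝ) :
    ‖fiGaussSector α q p z₀ M N' θ C P τ‖ ≤ secW M θ N' * (9 * boxDivSum (secL θ N') (secY θ N')) := by
  have hA := norm_fiGaussSector_le_sum_wCount hα q p z₀ M N' θ C P τ
  have hB := sum_wCount_le_secW_mul_boxSum hq1 hp1 hθ hθ1 hqs hM hN' z₀ C P τ
  have hC := sum_box_tau_le ⌈Real.sqrt N' * Real.cos φ - 9 * θ * Real.sqrt N'⌉
    ⌊Real.sqrt N' * Real.cos φ + 9 * θ * Real.sqrt N'⌋ ⌈Real.sqrt N' * Real.sin φ - 9 * θ * Real.sqrt N'⌉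
    ⌊Real.sqrt N' * Real.sin φ + 9 * θ * Real.sqrt N'⌋ (secY θ N')
  -- the sides of the square are at most `L = ⌊18 θ √N'⌋`
  have hR : 0 ≤ 9 * θ * Real.sqrt N' := by positivity
  have hlen : ∀ c : ℝ, (⌊c + 9 * θ * Real.sqrt N'⌋ - ⌈c - 9 * θ * Real.sqrt N'⌉).toNat ≤ secL θ N' := by
    intro c
    unfold secL
    apply Nat.le_floor
    have h := toNat_floor_sub_ceil_le (c := c) hR
    linarith
  have hD : ∀ d ∈ smallModuli (secY θ N'),
      ((((⌊Real.sqrt N' * Real.cos φ + 9 * θ * Real.sqrt N'⌋ -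
          ⌈Real.sqrt N' * Real.cos φ - 9 * θ * Real.sqrt N'⌉).toNat / d + 1) *
        ((⌊Real.sqrt N' * Real.sin φ + 9 * θ * Real.sqrt N'⌋ -
          ⌈Real.sqrt N' * Real.sin φ - 9 * θ * Real.sqrt N'⌉).toNat / d + 1) : ℕ) : ℝ) ≤
      ((secL θ N' / d + 1 : ℕ) : ℝ) ^ 2 := by
    intro d _
    rw [sq]
    exact_mod_cast Nat.mul_le_mul (Nat.add_le_add_right (Nat.div_le_div_right (hlen _)) 1)
      (Nat.add_le_add_right (Nat.div_le_div_right (hlen _)) 1)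
  have hC' : 9 * ∑ d ∈ smallModuli (secY θ N'), (#d.divisors : ℝ) ^ 2 * d *
      ((((⌊Real.sqrt N' * Real.cos φ + 9 * θ * Real.sqrt N'⌋ -
          ⌈Real.sqrt N' * Real.cos φ - 9 * θ * Real.sqrt N'⌉).toNat / d + 1) *
        ((⌊Real.sqrt N' * Real.sin φ + 9 * θ * Real.sqrt N'⌋ -
          ⌈Real.sqrt N' * Real.sin φ - 9 * θ * Real.sqrt N'⌉).toNat / d + 1) : ℕ) : ℝ) ≤
      9 * boxDivSum (secL θ N') (secY θ N') := by
    unfold boxDivSum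
    refine mul_le_mul_of_nonneg_left (sum_le_sum fun d hd => ?_) (by norm_num)
    exact mul_le_mul_of_nonneg_left (hD d hd) (by positivity)
  calc _ ≤ _ := hA
    _ ≤ _ := hB
    _ ≤ secW M θ N' * (9 * boxDivSum (secL θ N') (secY θ N')) :=
        mul_le_mul_of_nonneg_left (hC.trans hC') (secW_nonneg _ _ _)


/-! ### `Σ_{d ≤ K} τ(d)²/d ≤ (1 + log K)⁴` (local copy of the tree's `divPowSum_le` pattern) -/

/-- `Σ_{n ≤ K} τ(n)^{j+1}/n ≤ (Σ_{n ≤ K} τ(n)^j/n)²` (the multiplication map from divisor pairs; a local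
copy of `Literature.NumberTheory.Sieve.divPowSum_succ_le`, not imported to keep the closure small). [folklore] -/
theorem sum_tau_pow_succ_div_le (j K : ℕ) :
    ∑ n ∈ Icc 1 K, (#n.divisors : ℝ) ^ (j + 1) / n ≤
      (∑ n ∈ Icc 1 K, (#n.divisors : ℝ) ^ j / n) ^ 2 := by
  classical
  have card_divisors_mul_le : ∀ a b : ℕ, #(a * b).divisors ≤ #a.divisors * #b.divisors :=
    fun a b ↦ by rw [Nat.divisors_mul]; exact Finset.card_mul_le
  have card_divisorsAntidiagonal_eq : ∀ n : ℕ, #n.divisorsAntidiagonal = #n.divisors :=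
    fun n ↦ by rw [← Nat.map_div_right_divisors, Finset.card_map]
  have h1 : ∀ e ∈ Icc 1 K, (#e.divisors : ℝ) ^ (j + 1) / e =
      ∑ p ∈ Nat.divisorsAntidiagonal e, (#(p.1 * p.2).divisors : ℝ) ^ j / (p.1 * p.2 : ℕ) := by
    intro e _
    have hconst : ∀ p ∈ Nat.divisorsAntidiagonal e,
        (#(p.1 * p.2).divisors : ℝ) ^ j / (p.1 * p.2 : ℕ) = (#e.divisors : ℝ) ^ j / e := by
      intro p hp
      rw [(Nat.mem_divisorsAntidiagonal.mp hp).1]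
    rw [Finset.sum_congr rfl hconst, Finset.sum_const, card_divisorsAntidiagonal_eq,
      nsmul_eq_mul, pow_succ]
    ring
  rw [Finset.sum_congr rfl h1]
  have h2 : ∀ e ∈ Icc 1 K, ∑ p ∈ Nat.divisorsAntidiagonal e,
      (#(p.1 * p.2).divisors : ℝ) ^ j / (p.1 * p.2 : ℕ) ≤
      ∑ p ∈ Nat.divisorsAntidiagonal e,
        (#p.1.divisors : ℝ) ^ j / p.1 * ((#p.2.divisors : ℝ) ^ j / p.2) := by
    intro e _
    refine Finset.sum_le_sum fun p hp => ?_
    have hd : (#(p.1 * p.2).divisors : ℝ) ^ j ≤ (#p.1.divisors : ℝ) ^ j * (#p.2.divisors : ℝ) ^ j := by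
      rw [← mul_pow]
      exact pow_le_pow_left₀ (by positivity) (by exact_mod_cast card_divisors_mul_le p.1 p.2) j
    rw [div_mul_div_comm]
    push_cast
    exact div_le_div_of_nonneg_right hd (by positivity)
  refine (Finset.sum_le_sum h2).trans ?_
  rw [← Finset.sum_biUnion]
  · rw [sq, Finset.sum_mul_sum, ← Finset.sum_product']
    refine Finset.sum_le_sum_of_subset_of_nonneg ?_ fun p _ _ => by positivity
    intro p hp
    obtain ⟨e, he, hpe⟩ := Finset.mem_biUnion.mp hp
    have hp12 : p.1 * p.2 = e := (Nat.mem_divisorsAntidiagonal.mp hpe).1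
    have he0 : e ≠ 0 := (Nat.mem_divisorsAntidiagonal.mp hpe).2
    have heR : e ≤ K := (Finset.mem_Icc.mp he).2
    have hp1 : 0 < p.1 := Nat.pos_of_ne_zero fun h => he0 (by rw [← hp12, h, zero_mul])
    have hp2 : 0 < p.2 := Nat.pos_of_ne_zero fun h => he0 (by rw [← hp12, h, mul_zero])
    refine Finset.mem_product.mpr ⟨Finset.mem_Icc.mpr ⟨hp1, ?_⟩, Finset.mem_Icc.mpr ⟨hp2, ?_⟩⟩
    · calc p.1 ≤ p.1 * p.2 := Nat.le_mul_of_pos_right _ hp2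
        _ ≤ K := hp12 ▸ heR
    · calc p.2 ≤ p.1 * p.2 := Nat.le_mul_of_pos_left _ hp1
        _ ≤ K := hp12 ▸ heR
  · intro e _ e' _ hne
    rw [Function.onFun, Finset.disjoint_left]
    intro p hp hp'
    exact hne ((Nat.mem_divisorsAntidiagonal.mp hp).1.symm.trans (Nat.mem_divisorsAntidiagonal.mp hp').1)

/-- `Σ_{n ≤ K} τ(n)^j/n ≤ (1 + log K)^{2^j}`. [folklore] -/
theorem sum_tau_pow_div_le (j K : ℕ) :
    ∑ n ∈ Icc 1 K, (#n.divisors : ℝ) ^ j / n ≤ (1 + Real.log K) ^ (2 ^ j) := by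
  induction j with
  | zero =>
    have h := harmonic_le_one_add_log K
    rw [harmonic_eq_sum_Icc] at h
    push_cast at h
    simpa [one_div] using h
  | succ j ih =>
    calc ∑ n ∈ Icc 1 K, (#n.divisors : ℝ) ^ (j + 1) / n
        ≤ (∑ n ∈ Icc 1 K, (#n.divisors : ℝ) ^ j / n) ^ 2 := sum_tau_pow_succ_div_le j K
      _ ≤ ((1 + Real.log K) ^ (2 ^ j)) ^ 2 :=
          pow_le_pow_left₀ (Finset.sum_nonneg fun n _ ↦ by positivity) ih 2
      _ = (1 + Real.log K) ^ (2 ^ (j + 1)) := by rw [← pow_mul, pow_succ]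

/-- `Σ_{n ≤ K} τ(n)²/n ≤ (1 + log K)⁴`. [folklore] -/
theorem sum_tau_sq_div_le (K : ℕ) :
    ∑ n ∈ Icc 1 K, (#n.divisors : ℝ) ^ 2 / n ≤ (1 + Real.log K) ^ 4 := by
  simpa using sum_tau_pow_div_le 2 K

/-! ### The divisor sum of the trivial bound -/

/-- **`Σ_{d ≤ Y^{1/3}} τ(d)² d (⌊L/d⌋ + 1)² ≤ (Λ² + (2Λ + D) D)(1 + log Y)⁴`** for `L ≤ Λ` and any
`D ≥ 0` with `Y ≤ D³` ("`Σ_{d ≤ N^{1/3}} ρ(d) τ(d) d⁻¹ ≪ (log N)²`", here with `τ(d)` for `ρ(d)`).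
[cite: FriedlanderIwaniecAnnals1998, (5.16) proof] -/
theorem boxDivSum_le {L Y : ℕ} {Λ D : ℝ} (hLΛ : (L : ℝ) ≤ Λ) (hD : 0 ≤ D) (hYD : (Y : ℝ) ≤ D ^ 3) :
    boxDivSum L Y ≤ (Λ ^ 2 + (2 * Λ + D) * D) * (1 + Real.log Y) ^ 4 := by
  have hΛ0 : 0 ≤ Λ := (Nat.cast_nonneg L).trans hLΛ
  set V : ℝ := ∑ d ∈ smallModuli Y, (#d.divisors : ℝ) ^ 2 / d with hV
  have hV0 : 0 ≤ V := sum_nonneg fun d _ => by positivity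
  have hVle : V ≤ (1 + Real.log Y) ^ 4 :=
    (sum_le_sum_of_subset_of_nonneg (filter_subset _ _) fun d _ _ => by positivity).trans
      (sum_tau_sq_div_le Y)
  have hmem : ∀ d ∈ smallModuli Y, 0 < d ∧ (d : ℝ) ≤ D := by
    intro d hd
    obtain ⟨hd1, hd3⟩ := mem_filter.mp hd
    refine ⟨(mem_Icc.mp hd1).1, ?_⟩
    have h : ((d : ℝ)) ^ 3 ≤ D ^ 3 := by
      calc ((d : ℝ)) ^ 3 = ((d ^ 3 : ℕ) : ℝ) := by push_cast; ring
        _ ≤ Y := by exact_mod_cast hd3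
        _ ≤ D ^ 3 := hYD
    exact (pow_le_pow_iff_left₀ (by positivity) hD (by norm_num)).mp h
  -- termwise: `τ² d (L/d+1)² ≤ τ² (Λ²/d + (2Λ + D))`
  have hterm : ∀ d ∈ smallModuli Y, (#d.divisors : ℝ) ^ 2 * d * ((L / d + 1 : ℕ) : ℝ) ^ 2 ≤
      Λ ^ 2 * ((#d.divisors : ℝ) ^ 2 / d) + (2 * Λ + D) * D * ((#d.divisors : ℝ) ^ 2 / d) := by
    intro d hd
    obtain ⟨hd0, hdD⟩ := hmem d hd
    have hd0' : (0 : ℝ) < d := by exact_mod_cast hd0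
    have h1 : ((L / d + 1 : ℕ) : ℝ) ≤ Λ / d + 1 := by
      push_cast
      have h0 : ((L / d : ℕ) : ℝ) ≤ (L : ℝ) / d := Nat.cast_div_le
      have h0' : (L : ℝ) / d ≤ Λ / d := div_le_div_of_nonneg_right hLΛ hd0'.le
      linarith
    have h2 : ((L / d + 1 : ℕ) : ℝ) ^ 2 ≤ (Λ / d + 1) ^ 2 :=
      pow_le_pow_left₀ (by positivity) h1 2
    calc (#d.divisors : ℝ) ^ 2 * d * ((L / d + 1 : ℕ) : ℝ) ^ 2
        ≤ (#d.divisors : ℝ) ^ 2 * d * (Λ / d + 1) ^ 2 :=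
          mul_le_mul_of_nonneg_left h2 (by positivity)
      _ = ((#d.divisors : ℝ) ^ 2 / d) * (Λ ^ 2 + (2 * Λ + d) * d) := by
          field_simp
          ring
      _ ≤ ((#d.divisors : ℝ) ^ 2 / d) * (Λ ^ 2 + (2 * Λ + D) * D) := by
          apply mul_le_mul_of_nonneg_left _ (by positivity)
          nlinarith
      _ = _ := by ring
  calc boxDivSum L Y = ∑ d ∈ smallModuli Y, (#d.divisors : ℝ) ^ 2 * d *
        ((L / d + 1 : ℕ) : ℝ) ^ 2 := rfl
    _ ≤ ∑ d ∈ smallModuli Y, (Λ ^ 2 * ((#d.divisors : ℝ) ^ 2 / d) +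
        (2 * Λ + D) * D * ((#d.divisors : ℝ) ^ 2 / d)) := sum_le_sum hterm
    _ = (Λ ^ 2 + (2 * Λ + D) * D) * V := by
        rw [sum_add_distrib, ← mul_sum, ← mul_sum]; ring
    _ ≤ (Λ ^ 2 + (2 * Λ + D) * D) * (1 + Real.log Y) ^ 4 :=
        mul_le_mul_of_nonneg_left hVle (by positivity)

/-- The case of the polar box: `L = ⌊18 θ √N'⌋ ≤ Λ = 18 θ √N'`. [cite: FriedlanderIwaniecAnnals1998, (5.16) proof] -/
theorem secDivSum_le {θ N' D : ℝ} (hθ : 0 ≤ θ) (hD : 0 ≤ D) (hYD : (secY θ N' : ℝ) ≤ D ^ 3) :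
    boxDivSum (secL θ N') (secY θ N') ≤
      ((18 * θ * Real.sqrt N') ^ 2 + (2 * (18 * θ * Real.sqrt N') + D) * D) *
        (1 + Real.log (secY θ N')) ^ 4 :=
  boxDivSum_le (Nat.floor_le (by positivity)) hD hYD

/-! ### The trivial bound in closed form -/

/-- `boxDivSum ≥ 0`. [folklore] -/
theorem boxDivSum_nonneg (L Y : ℕ) : 0 ≤ boxDivSum L Y := sum_nonneg fun d _ => by positivity

/-- `√x · √(√x) = x^{3/4}` for `x ≥ 0`. [folklore] -/
theorem sqrt_mul_sqrt_sqrt {x : ℝ} (hx : 0 ≤ x) :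
    Real.sqrt x * Real.sqrt (Real.sqrt x) = x ^ (3 / 4 : ℝ) := by
  rw [Real.sqrt_eq_rpow, Real.sqrt_eq_rpow, ← Real.rpow_mul hx, ← Real.rpow_add' hx (by norm_num)]
  norm_num

/-- `Y = ⌊(1+θ)N'⌋ ≤ (3/2) N'` for `θ ≤ 1/2`, `N' ≥ 0`. [folklore] -/
theorem secY_le {θ N' : ℝ} (hθ0 : 0 ≤ θ) (hθ1 : θ ≤ 1 / 2) (hN' : 0 ≤ N') :
    (secY θ N' : ℝ) ≤ 3 / 2 * N' := by
  unfold secY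
  refine (Nat.floor_le (by positivity)).trans ?_
  nlinarith

/-- `1 ≤ Y` for `N' ≥ 1`. [folklore] -/
theorem one_le_secY {θ N' : ℝ} (hθ0 : 0 ≤ θ) (hN' : 1 ≤ N') : 1 ≤ secY θ N' := by
  unfold secY
  apply Nat.le_floor
  push_cast
  nlinarith

/-- **`W ≤ 25 (MN')^{1/4} (M/N')^{1/2}`** for `1 ≤ N' ≤ M`, `0 ≤ θ ≤ 1/2`. [folklore] -/
theorem secW_le {M θ N' : ℝ} (hθ0 : 0 ≤ θ) (hθ1 : θ ≤ 1 / 2) (hN' : 1 ≤ N') (hMN : N' ≤ M) :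
    secW M θ N' ≤ 25 * Real.sqrt (Real.sqrt (M * N')) * Real.sqrt (M / N') := by
  have hN'0 : 0 < N' := by linarith
  have hM0 : 0 ≤ M := by linarith
  set qq : ℝ := Real.sqrt (Real.sqrt (M * N')) with hqq
  set rr : ℝ := Real.sqrt (M / N') with hrr
  have hMN1 : 1 ≤ M * N' := by nlinarith
  have hq1 : 1 ≤ qq := Real.one_le_sqrt.mpr (Real.one_le_sqrt.mpr hMN1)
  have hr1 : 1 ≤ rr := Real.one_le_sqrt.mpr ((one_le_div hN'0).mpr hMN)
  -- the first factor
  have hK : ((⌊2 * M⌋₊ * secY θ N' : ℕ) : ℝ) ≤ 3 * (M * N') := by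
    push_cast
    calc (⌊2 * M⌋₊ : ℝ) * (secY θ N' : ℝ) ≤ (2 * M) * (3 / 2 * N') :=
          mul_le_mul (Nat.floor_le (by positivity)) (secY_le hθ0 hθ1 hN'0.le) (Nat.cast_nonneg _)
            (by positivity)
      _ = 3 * (M * N') := by ring
  have h4 : Real.sqrt (Real.sqrt 3) ≤ 1.32 := by
    rw [Real.sqrt_le_iff]
    refine ⟨by norm_num, ?_⟩
    rw [Real.sqrt_le_iff]
    constructor <;> norm_num
  have hc : ((Nat.sqrt (Nat.sqrt (⌊2 * M⌋₊ * secY θ N')) : ℕ) : ℝ) ≤ 1.32 * qq := by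
    calc ((Nat.sqrt (Nat.sqrt (⌊2 * M⌋₊ * secY θ N')) : ℕ) : ℝ)
        ≤ Real.sqrt (Nat.sqrt (⌊2 * M⌋₊ * secY θ N') : ℕ) := Real.nat_sqrt_le_real_sqrt
      _ ≤ Real.sqrt (Real.sqrt ((⌊2 * M⌋₊ * secY θ N' : ℕ) : ℝ)) :=
          Real.sqrt_le_sqrt Real.nat_sqrt_le_real_sqrt
      _ ≤ Real.sqrt (Real.sqrt (3 * (M * N'))) := Real.sqrt_le_sqrt (Real.sqrt_le_sqrt hK)
      _ = Real.sqrt (Real.sqrt 3) * qq := by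
          rw [Real.sqrt_mul (by norm_num), Real.sqrt_mul (Real.sqrt_nonneg _), hqq]
      _ ≤ 1.32 * qq := mul_le_mul_of_nonneg_right h4 (by positivity)
  have hA : (2 * (Nat.sqrt (Nat.sqrt (⌊2 * M⌋₊ * secY θ N')) : ℝ) + 1) ≤ 3.64 * qq := by linarith
  -- the second factor
  have h2 : Real.sqrt 2 ≤ 1.415 := by
    rw [Real.sqrt_le_iff]; constructor <;> norm_num
  have hB : 4 * Real.sqrt (2 * M / N') + 1 ≤ 6.66 * rr := by
    have e : Real.sqrt (2 * M / N') = Real.sqrt 2 * rr := by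
      rw [hrr, ← Real.sqrt_mul (by norm_num)]; congr 1; ring
    rw [e]
    nlinarith
  calc secW M θ N' = (2 * (Nat.sqrt (Nat.sqrt (⌊2 * M⌋₊ * secY θ N')) : ℝ) + 1) *
        (4 * Real.sqrt (2 * M / N') + 1) := rfl
    _ ≤ (3.64 * qq) * (6.66 * rr) := mul_le_mul hA hB (by positivity) (by positivity)
    _ ≤ 25 * qq * rr := by nlinarith [mul_nonneg (by positivity : (0 : ℝ) ≤ qq) (by positivity : (0 : ℝ) ≤ rr)]

/-- **FI (5.16), the trivial bound for a sector form**: for `|α| ≤ 1`, `|p| ≤ 1`, `|q| ≤ 1` with `q`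
supported on `φ < u ≤ φ + 2πθ (mod 2π)`, `0 < θ ≤ 1/2`, `1 ≤ N' ≤ M` and `θ ≥ N'^{-1/6}` (as
`N' ≤ (θ√N')³`): `‖B(M, N)‖ ≤ 10⁶ θ² (MN')^{3/4} (1 + log N')⁴` — the printed
"`B(M, N) ≪ θ² (MN)^{3/4} (log N)²`" with `(log)⁴` (we use `τ(d)` in place of `ρ(d)`), uniformly in
the class `z₀`, the sector `φ`, and `C, P, τ`. [cite: FriedlanderIwaniecAnnals1998, (5.16)] -/
theorem norm_fiGaussSector_le_trivial {α : ℕ → ℂ} (hα : ∀ m, ‖α m‖ ≤ 1) {q p : ℝ → ℝ}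
    (hq1 : ∀ u, |q u| ≤ 1) (hp1 : ∀ u, |p u| ≤ 1) {θ φ : ℝ} (hθ : 0 < θ) (hθ1 : θ ≤ 1 / 2)
    (hqs : ∀ u, q u ≠ 0 → ∃ k : ℤ, φ < u - 2 * π * k ∧ u - 2 * π * k ≤ φ + 2 * π * θ)
    {M N' : ℝ} (hN' : 1 ≤ N') (hMN : N' ≤ M) (hθN : N' ≤ (θ * Real.sqrt N') ^ 3)
    (z₀ : GaussianInt) (C P τ : ℝ) :
    ‖fiGaussSector α q p z₀ M N' θ C P τ‖ ≤
      10 ^ 6 * θ ^ 2 * (M * N') ^ (3 / 4 : ℝ) * (1 + Real.log N') ^ 4 := by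
  have hN'0 : 0 < N' := by linarith
  have hM0 : 0 ≤ M := by linarith
  have h1 := norm_fiGaussSector_le_secW_mul_boxDivSum hα hq1 hp1 hθ hθ1 hqs hM0 hN'0 z₀ C P τ
  have hW := secW_le hθ.le hθ1 hN' hMN
  -- the divisor sum
  set D : ℝ := 1.2 * (θ * Real.sqrt N') with hD
  have hD0 : 0 ≤ D := by positivity
  have hYD : (secY θ N' : ℝ) ≤ D ^ 3 := by
    calc (secY θ N' : ℝ) ≤ 3 / 2 * N' := secY_le hθ.le hθ1 hN'0.le
      _ ≤ 1.728 * (θ * Real.sqrt N') ^ 3 := by nlinarith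
      _ = D ^ 3 := by rw [hD]; ring
  have hDiv := secDivSum_le hθ.le hD0 hYD
  have hsq : Real.sqrt N' ^ 2 = N' := Real.sq_sqrt hN'0.le
  have hcoef : (18 * θ * Real.sqrt N') ^ 2 + (2 * (18 * θ * Real.sqrt N') + D) * D =
      368.64 * (θ ^ 2 * N') := by
    rw [hD]; nlinarith [hsq]
  -- the logarithm
  have hY1 : (1 : ℝ) ≤ secY θ N' := by exact_mod_cast one_le_secY hθ.le hN'
  have hlogN : 0 ≤ Real.log N' := Real.log_nonneg hN'
  have hlogY0 : 0 ≤ 1 + Real.log (secY θ N') := by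
    have := Real.log_nonneg hY1; linarith
  have hlogY : 1 + Real.log (secY θ N') ≤ 3 / 2 * (1 + Real.log N') := by
    have h := Real.log_le_log (by linarith) (secY_le hθ.le hθ1 hN'0.le)
    rw [Real.log_mul (by norm_num) hN'0.ne'] at h
    have h32 : Real.log (3 / 2 : ℝ) ≤ 1 / 2 := by
      have := Real.log_le_sub_one_of_pos (by norm_num : (0 : ℝ) < 3 / 2); linarith
    linarith
  have hlog4 : (1 + Real.log (secY θ N')) ^ 4 ≤ (3 / 2 * (1 + Real.log N')) ^ 4 :=
    pow_le_pow_left₀ hlogY0 hlogY 4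
  have hDiv' : boxDivSum (secL θ N') (secY θ N') ≤ 368.64 * (θ ^ 2 * N') * (3 / 2 * (1 + Real.log N')) ^ 4 := by
    rw [hcoef] at hDiv
    exact hDiv.trans (mul_le_mul_of_nonneg_left hlog4 (by positivity))
  -- the main variables
  set qq : ℝ := Real.sqrt (Real.sqrt (M * N')) with hqq
  set rr : ℝ := Real.sqrt (M / N') with hrr
  have hqr : qq * rr * N' = (M * N') ^ (3 / 4 : ℝ) := by
    have e1 : rr * N' = Real.sqrt (M * N') := by
      rw [hrr, show M * N' = M / N' * N' ^ 2 by field_simp, Real.sqrt_mul (div_nonneg hM0 hN'0.le),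
        Real.sqrt_sq hN'0.le]
    rw [mul_assoc, e1, hqq, mul_comm]
    exact sqrt_mul_sqrt_sqrt (by positivity)
  calc ‖fiGaussSector α q p z₀ M N' θ C P τ‖ ≤ secW M θ N' * (9 * boxDivSum (secL θ N') (secY θ N')) := h1
    _ ≤ (25 * qq * rr) * (9 * (368.64 * (θ ^ 2 * N') * (3 / 2 * (1 + Real.log N')) ^ 4)) :=
        mul_le_mul hW (mul_le_mul_of_nonneg_left hDiv' (by norm_num))
          (mul_nonneg (by norm_num) (boxDivSum_nonneg _ _)) (by positivity)
    _ = 419904 * θ ^ 2 * (qq * rr * N') * (1 + Real.log N') ^ 4 := by ring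
    _ = 419904 * θ ^ 2 * (M * N') ^ (3 / 4 : ℝ) * (1 + Real.log N') ^ 4 := by rw [hqr]
    _ ≤ 10 ^ 6 * θ ^ 2 * (M * N') ^ (3 / 4 : ℝ) * (1 + Real.log N') ^ 4 := by
        gcongr; norm_num

end Literature.NumberTheory.Sieve.FriedlanderIwaniecPrimes
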